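import Literature.Analysis.FluidPDE.OnsagerBDSVEnergyCorrector
import Literature.Analysis.FluidPDE.OnsagerBDSVDeformationBoundsTildeR
import Literature.Analysis.FluidPDE.OnsagerBDSVOscillationPrincipal
import HarnessLib

/-!
# The BDSV perturbation: proof of the bound on the principal part `w_o` (Cor. 5.8, arXiv (5.29))

Buckmaster–De Lellis–Székelyhidi–Vicol (BDSV), *Onsager's conjecture for admissible weak
solutions*, CPAM 72 (2019) = arXiv:1701.08678, Cor. 5.8, first item (arXiv (5.29)):
`‖w_o‖₀ + λ_{q+1}⁻¹‖w_o‖₁ ≤ (M/4) δ_{q+1}^{1/2}` for `a` sufficiently large. This file PROVES the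
named fact `BDSV.principalPartBound` of `OnsagerBDSVCorrectorBounds.lean`
(`BDSV.principalPartBound_holds`), i.e. the transcription with an existential constant `C` along
the common prefix `BDSV.StageFact`, for the honest principal part
`w_o = ∑_i ρ_{q,i}^{1/2} adj(∇Φ_i) W(R̃_{q,i}, n_{q+1}Φ_i)` (`BDSV.principalPart`).

The printed proof (arXiv (5.32)–(5.35)): `‖(∇Φ_i)⁻¹‖₀ ≤ 2` on `supp η_i`, the `w_{o,i}` have
disjoint supports, whence `‖w_o‖₀ ≲ δ_{q+1}^{1/2}` (this half is the tree's
`BDSV.PerturbationData.norm_principalPart_le`, `OnsagerBDSVEnergyCorrector.lean`); for `‖w_o‖₁`,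
"`‖∇e^{iλ_{q+1}k·Φ_i}‖₀ ≤ λ_{q+1}|k|‖∇Φ_i‖₀ ≤ 2λ_{q+1}|k|`" and
"`∇w_{o,i} = Σ_k (∇Φ_i)⁻¹ b_{i,k} ∇e^{iλ_{q+1}k·Φ_i} + Σ_k ∇((∇Φ_i)⁻¹ b_{i,k}) e^{iλ_{q+1}k·Φ_i}`", so
that by Prop. 5.7 (`‖(∇Φ_i)⁻¹‖_N + ‖∇Φ_i‖_N ≲ ℓ^{-N}`, `‖R̃_{q,i}‖_N ≲ ℓ^{-N}`)
`‖∇w_o‖₀ ≤ (M/16)δ_{q+1}^{1/2}λ_{q+1} + C̄ δ_{q+1}^{1/2}ℓ⁻¹`, and finally `(ℓλ_{q+1})⁻¹ ≤ 1` for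
`b > (1-β+3α/2)/(1-β)` and `a` large. Here the same computation is carried out on the closed form
`ρ_{q,i}^{1/2} adj(∇Φ_i) W(R̃_{q,i}, n_{q+1}Φ_i)` of `w_{o,i}` (no Fourier expansion is needed for an
unspecified constant): by the Leibniz and chain rules,
`∂_j w_{o,i} = ∂_jρ_{q,i}^{1/2} adj∇Φ_i W + ρ_{q,i}^{1/2} ∂_j(adj∇Φ_i) W + ρ_{q,i}^{1/2} adj∇Φ_i (D_R W ∂_jR̃_{q,i} + D_ξ W n_{q+1}∂_jΦ_i)`,
with `|∂_jρ_{q,i}^{1/2}| ≲ δ_{q+1}^{1/2}` (Lemma 5.3, Lemma 5.4), `‖∂_j adj∇Φ_i‖ ≲ ℓ⁻¹`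
(Prop. 5.7 (5.23), the tree's PROVED `BDSV.gradPhiBound_holds`, `adj∇Φ_i = (∇Φ_i)⁻¹` as
`det ∇Φ_i = 1`), `‖∂_jR̃_{q,i}‖ ≲ ℓ⁻¹` (the computation (5.27)–(5.28) of the proof of Prop. 5.7 at
`N = 1`), `D W` bounded on the compact set of matrices met (Remark 5.2), `‖∂_jΦ_i‖ ≤ e^{4C_in}`
(Lemma 5.4); at every point at most one cut-off is active (and `∂_j w_{o,i} = 0` off `supp η_i`,
since `η_i ≥ 0` vanishes there to first order), and (6.6) `ℓ⁻¹ ≤ λ_{q+1}`, `n_{q+1} ≤ λ_{q+1}`.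

Contents: a Leibniz rule on `T³` for continuous bilinear maps and Fermat at zeros of nonnegative
functions (`BDSV.partialDeriv_bilinear_apply`, `BDSV.partialDeriv_eq_zero_of_nonneg_of_eq_zero`);
the chain rule through a Mikado profile (`BDSV.norm_partialDeriv_mikado_comp_le`, bounds on `D¹W`
being those of `OnsagerBDSVMikadoBounds.lean`); pointwise Leibniz bounds for `ρ^{1/2} A v` and for
`G M Gᵀ`; the pointwise bounds on `∂ⱼρ_{q,i}^{1/2}`, `∂ⱼadj∇Φ_i`, `∂ⱼR̃_{q,i}`,
`∂ⱼ[W(R̃_{q,i}, n_{q+1}Φ_i)]` under `BDSV.PerturbationHypotheses`; the derivative bound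
`BDSV.PerturbationData.norm_partialDeriv_principalPart_le`; and the assembly
`BDSV.principalPartBound_holds`. The summands `w_{o,i}` are `BDSV.principalSummand`
(`OnsagerBDSVOscillationPrincipal.lean`); `‖ofCols ·‖ ≤ ‖·‖` and `0 ≤ Σ∫η²/ρ_q ≤ 8λ_q^α/δ_{q+1}`
are those of `OnsagerBDSVDeformationBoundsTildeR.lean`.

## References

* T. Buckmaster, C. De Lellis, L. Székelyhidi Jr., V. Vicol, *Onsager's conjecture for admissible
  weak solutions*, Comm. Pure Appl. Math. 72 (2019) 229–274 = arXiv:1701.08678, §5.5 Cor. 5.8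
  (arXiv (5.29)) and its proof (arXiv (5.32)–(5.35)); Prop. 5.7 (arXiv (5.23)–(5.24)) and its
  proof (arXiv (5.27)–(5.28)); Lemma 5.3; Lemma 5.4; Remark 5.2; §6.1.1 (6.6). Equation numbers
  as in arXiv:1701.08678v1.
-/

open MeasureTheory Set
open scoped NNReal ENNReal ContDiff Matrix Matrix.Norms.Elementwise

noncomputable section

namespace Literature.Analysis.FluidPDE

namespace BDSV

open FunctionSpaces FunctionSpaces.Torus

/-! ## Torus calculus: a bilinear Leibniz rule, Fermat at zeros of nonnegative functions -/

section TorusCalculus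

variable {E₁ E₂ E₃ : Type*} [NormedAddCommGroup E₁] [NormedSpace ℝ E₁]
  [NormedAddCommGroup E₂] [NormedSpace ℝ E₂] [NormedAddCommGroup E₃] [NormedSpace ℝ E₃]

/-- **Leibniz rule on the torus for a continuous bilinear map**: for smooth `f`, `g` on `T³`,
`∂ⱼ B(f, g) = B(f, ∂ⱼ g) + B(∂ⱼ f, g)`. [folklore] -/
theorem partialDeriv_bilinear_apply (B : E₁ →L[ℝ] E₂ →L[ℝ] E₃) {f : (UnitAddTorus (Fin 3)) → E₁} {g : (UnitAddTorus (Fin 3)) → E₂}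
    (hf : IsSmooth f) (hg : IsSmooth g) (j : Fin 3) (x : (UnitAddTorus (Fin 3))) :
    partialDeriv j (fun y => B (f y) (g y)) x =
      B (f x) (partialDeriv j g x) + B (partialDeriv j f x) (g x) := by
  have h := (B.hasDerivAt_of_bilinear (fun _ => hf.hasDerivAt_line_zero j x)
    (fun _ => hg.hasDerivAt_line_zero j x)).deriv
  simp only [zero_smul, proj_zero, add_zero] at h
  exact h

/-- **Fermat on the torus**: a smooth nonnegative function has vanishing partial derivatives at
its zeros. [folklore] -/
theorem partialDeriv_eq_zero_of_nonneg_of_eq_zero {g : (UnitAddTorus (Fin 3)) → ℝ} (hg : IsSmooth g)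
    (h0 : ∀ y, 0 ≤ g y) {x : (UnitAddTorus (Fin 3))} (hx : g x = 0) (j : Fin 3) : partialDeriv j g x = 0 := by
  have hmin : IsLocalMin (fun t : ℝ => g (x + proj (t • EuclideanSpace.single j (1 : ℝ)))) 0 := by
    refine Filter.Eventually.of_forall fun t => ?_
    have e0 : g (x + proj ((0 : ℝ) • EuclideanSpace.single j (1 : ℝ))) = 0 := by
      rw [zero_smul, proj_zero, add_zero]; exact hx
    show g (x + proj ((0 : ℝ) • _)) ≤ g (x + proj (t • _))
    rw [e0]
    exact h0 _
  exact hmin.hasDerivAt_eq_zero (hg.hasDerivAt_line_zero j x)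

/-- A matrix field on `T³` with smooth entries is smooth (elementwise sup norm). [folklore] -/
theorem isSmooth_matrix_of_entries {A : (UnitAddTorus (Fin 3)) → (Matrix (Fin 3) (Fin 3) ℝ)} (hA : ∀ a b, IsSmooth (fun x => A x a b)) :
    IsSmooth A :=
  contDiff_pi.2 fun a => contDiff_pi.2 fun b => hA a b

/-- The entries of a smooth matrix field are smooth. [folklore] -/
theorem isSmooth_entry_of_matrix {A : (UnitAddTorus (Fin 3)) → (Matrix (Fin 3) (Fin 3) ℝ)} (hA : IsSmooth A) (a b : Fin 3) :
    IsSmooth (fun x => A x a b) :=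
  (contDiff_pi.1 ((contDiff_pi.1 hA) a)) b

/-- Products of smooth matrix fields are smooth (entrywise: finite sums of products).
[folklore] -/
theorem _root_.Literature.Analysis.FunctionSpaces.Torus.IsSmooth.matrix_mul {G M : (UnitAddTorus (Fin 3)) → (Matrix (Fin 3) (Fin 3) ℝ)}
    (hG : IsSmooth G) (hM : IsSmooth M) : IsSmooth (fun y => G y * M y) := by
  refine isSmooth_matrix_of_entries fun a b => ?_
  have e : (fun y => (G y * M y) a b) = fun y => ∑ k, G y a k * M y k b := by
    funext y
    rw [Matrix.mul_apply]
  rw [e]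
  exact Torus.isSmooth_finset_sum _ fun k _ =>
    (isSmooth_entry_of_matrix hG a k).mul (isSmooth_entry_of_matrix hM k b)

/-- The adjugate of a `3 × 3` matrix field with smooth entries is smooth (its entries are
differences of products of two entries). [folklore] -/
theorem isSmooth_adjugate_of_entries {A : (UnitAddTorus (Fin 3)) → (Matrix (Fin 3) (Fin 3) ℝ)} (hA : ∀ a b, IsSmooth (fun x => A x a b)) :
    IsSmooth (fun x => (A x).adjugate) := by
  refine isSmooth_matrix_of_entries fun a b => ?_
  obtain ⟨p, q, u, w, p', q', u', w', hrep⟩ := adjugate_fin_three_entry a b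
  have e : (fun x => (A x).adjugate a b) =
      (fun x => A x p q * A x u w) - fun x => A x p' q' * A x u' w' := by
    funext x
    simp only [Pi.sub_apply, hrep]
  rw [e]
  exact IsSmooth.sub ((hA p q).mul (hA u w)) ((hA p' q').mul (hA u' w'))

/-- `‖Df(a) w‖ ≤ ‖D¹f(a)‖ ‖w‖` (the operator norm of the first derivative written through the
`1`-multilinear form `D¹f`, which is the form in which uniform bounds on Mikado profiles are
recorded in `OnsagerBDSVMikadoBounds.lean`). [folklore] -/
theorem norm_fderiv_apply_le_norm_iteratedFDeriv_one_mul {E F : Type*} [NormedAddCommGroup E]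
    [NormedSpace ℝ E] [NormedAddCommGroup F] [NormedSpace ℝ F] (f : E → F) (a w : E) :
    ‖fderiv ℝ f a w‖ ≤ ‖iteratedFDeriv ℝ 1 f a‖ * ‖w‖ := by
  have h := (iteratedFDeriv ℝ 1 f a).le_opNorm (fun _ => w)
  rw [iteratedFDeriv_one_apply] at h
  simpa only [Fin.prod_univ_one] using h

end TorusCalculus

/-! ## The chain rule through a Mikado profile -/

section MikadoChain

/-- **Chain rule through a Mikado profile** (the computation behind arXiv (5.34)
"`‖∇e^{iλ_{q+1}k·Φ_i}‖₀ ≤ λ_{q+1}|k|‖∇Φ_i‖₀`" for the whole profile at once): for smooth fields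
`Rm : T³ → 𝕄`, `D₀ : T³ → ℝ³` and a profile with smooth lift whose first derivative is bounded by
`C_V` on `{Rm(x)} × ℝ³`, the field `y ↦ V(Rm(y), n(y + D₀(y)))` has
`‖∂ⱼ[V(Rm, n(· + D₀))](x)‖ ≤ C_V max(‖∂ⱼRm(x)‖, n‖eⱼ + ∂ⱼD₀(x)‖)`.
[cite: BuckmasterEtAl2018, Cor. 5.8 (proof, arXiv (5.34))] -/
theorem norm_partialDeriv_mikado_comp_le {V : (Matrix (Fin 3) (Fin 3) ℝ) → (UnitAddTorus (Fin 3)) → (EuclideanSpace ℝ (Fin 3))} (hV : ContDiff ℝ ∞ (mikadoLift V))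
    {Rm : (UnitAddTorus (Fin 3)) → (Matrix (Fin 3) (Fin 3) ℝ)} {D₀ : (UnitAddTorus (Fin 3)) → (EuclideanSpace ℝ (Fin 3))} (hRm : IsSmooth Rm) (hD₀ : IsSmooth D₀) (n : ℕ) {x : (UnitAddTorus (Fin 3))}
    {CV : ℝ} (hCV0 : 0 ≤ CV)
    (hCV : ∀ ξ : (EuclideanSpace ℝ (Fin 3)), ‖iteratedFDeriv ℝ 1 (mikadoLift V) (Rm x, ξ)‖ ≤ CV) (j : Fin 3) :
    ‖partialDeriv j (fun y => V (Rm y) (n • (y + proj (D₀ y)))) x‖ ≤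
      CV * max ‖partialDeriv j Rm x‖
        ((n : ℝ) * ‖EuclideanSpace.single j (1 : ℝ) + partialDeriv j D₀ x‖) := by
  set e : (EuclideanSpace ℝ (Fin 3)) := EuclideanSpace.single j (1 : ℝ) with he
  set x₀ : (EuclideanSpace ℝ (Fin 3)) := repr x with hx₀
  have hx : proj x₀ = x := proj_repr x
  -- the inner map along the coordinate line and its derivative at `0`
  set ψ : ℝ → (Matrix (Fin 3) (Fin 3) ℝ) × (EuclideanSpace ℝ (Fin 3)) := fun s =>
    (Rm (x + proj (s • e)), (n : ℝ) • ((x₀ + s • e) + D₀ (x + proj (s • e)))) with hψ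
  have hψ' : HasDerivAt ψ (partialDeriv j Rm x, (n : ℝ) • (e + partialDeriv j D₀ x)) 0 := by
    refine (hRm.hasDerivAt_line_zero j x).prodMk ?_
    have h1 : HasDerivAt (fun s : ℝ => x₀ + s • e) e 0 := by
      have h := ((hasDerivAt_id (0 : ℝ)).smul_const e).const_add x₀
      rwa [one_smul] at h
    exact (h1.add (hD₀.hasDerivAt_line_zero j x)).const_smul (n : ℝ)
  have hψ0 : ψ 0 = (Rm x, (n : ℝ) • (x₀ + D₀ x)) := by
    simp only [hψ, zero_smul, proj_zero, add_zero]
  -- the composite along the line is the line restriction of the field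
  have hdiff : DifferentiableAt ℝ (mikadoLift V) (ψ 0) :=
    (hV.differentiable (by simp)).differentiableAt
  have hcomp := hdiff.hasFDerivAt.comp_hasDerivAt (0 : ℝ) hψ'
  have hline : (mikadoLift V ∘ ψ) =
      fun s : ℝ => V (Rm (x + proj (s • e))) (n • ((x + proj (s • e)) + proj (D₀ (x + proj (s • e))))) := by
    funext s
    simp only [Function.comp_apply, hψ, mikadoLift_apply]
    congr 1
    rw [Nat.cast_smul_eq_nsmul, proj_nsmul, proj_add, proj_add, hx]
  rw [hline] at hcomp
  have hderiv : partialDeriv j (fun y => V (Rm y) (n • (y + proj (D₀ y)))) x =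
      fderiv ℝ (mikadoLift V) (ψ 0) (partialDeriv j Rm x, (n : ℝ) • (e + partialDeriv j D₀ x)) :=
    hcomp.deriv
  rw [hderiv, hψ0]
  refine (norm_fderiv_apply_le_norm_iteratedFDeriv_one_mul _ _ _).trans ?_
  refine mul_le_mul (hCV _) ?_ (norm_nonneg _) hCV0
  rw [Prod.norm_def]
  refine max_le_max le_rfl ?_
  rw [norm_smul, Real.norm_eq_abs, Nat.abs_cast]

end MikadoChain

/-! ## Matrix actions: `(A, u) ↦ A u` as a bilinear map, entry bounds -/

section MatrixAction

/-- The action `(A, u) ↦ A u` (`Matrix.toEuclideanLin A u`) of `3 × 3` matrices on `ℝ³` is the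
continuous bilinear map `BDSV.bmat ∘ BDSV.mtranspose` of `OnsagerBDSVMikadoBounds.lean`
(`bmat B u = Bᵀ u`) — the form in which the principal part `ρ^{1/2} adj(∇Φ) W` is differentiated
by the Leibniz rule. [folklore] -/
theorem bmat_comp_mtranspose_apply (A : (Matrix (Fin 3) (Fin 3) ℝ)) (u : (EuclideanSpace ℝ (Fin 3))) :
    (bmat.comp mtranspose) A u = Matrix.toEuclideanLin A u := rfl

/-- The action of a smooth matrix field on a smooth vector field is smooth. [folklore] -/
theorem isSmooth_toEuclideanLin {A : (UnitAddTorus (Fin 3)) → (Matrix (Fin 3) (Fin 3) ℝ)} {v : (UnitAddTorus (Fin 3)) → (EuclideanSpace ℝ (Fin 3))} (hA : IsSmooth A) (hv : IsSmooth v) :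
    IsSmooth (fun y => Matrix.toEuclideanLin (A y) (v y)) :=
  ((bmat.comp mtranspose).contDiff.comp hA).clm_apply hv

/-- The Euclidean norm on `ℝ³` is at most the sum of the coordinates' absolute values. [folklore] -/
theorem norm_le_sum_abs_three (u : (EuclideanSpace ℝ (Fin 3))) : ‖u‖ ≤ ∑ a, |u a| := by
  conv_lhs => rw [← (EuclideanSpace.basisFun (Fin 3) ℝ).sum_repr u]
  refine (norm_sum_le _ _).trans (Finset.sum_le_sum fun a _ => ?_)
  rw [EuclideanSpace.basisFun_repr, EuclideanSpace.basisFun_apply, norm_smul, Real.norm_eq_abs]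
  simp

/-- The `j`-th column `eⱼ + ∂ⱼD` of `∇Φ = Id + ∇D`, as a vector of `ℝ³`, has Euclidean norm at
most `3‖∇Φ‖_∞`. [folklore] -/
theorem norm_single_add_partialDeriv_le (D : ℕ → ℝ → (UnitAddTorus (Fin 3)) → (EuclideanSpace ℝ (Fin 3))) (i : ℕ) (t : ℝ) (x : (UnitAddTorus (Fin 3))) (j : Fin 3) :
    ‖EuclideanSpace.single j (1 : ℝ) + partialDeriv j (D i t) x‖ ≤ 3 * ‖gradPhi D i t x‖ := by
  refine (norm_le_sum_abs_three _).trans ?_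
  have h : ∀ a, |(EuclideanSpace.single j (1 : ℝ) + partialDeriv j (D i t) x) a| ≤ ‖gradPhi D i t x‖ := by
    intro a
    have e : (EuclideanSpace.single j (1 : ℝ) + partialDeriv j (D i t) x) a = gradPhi D i t x a j := by
      rw [gradPhi_apply, Matrix.one_apply]
      simp only [PiLp.add_apply, PiLp.single_apply]
    rw [e, ← Real.norm_eq_abs]
    exact Matrix.norm_entry_le_entrywise_sup_norm _
  calc ∑ a, |(EuclideanSpace.single j (1 : ℝ) + partialDeriv j (D i t) x) a|
      ≤ ∑ _a : Fin 3, ‖gradPhi D i t x‖ := Finset.sum_le_sum fun a _ => h a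
    _ = 3 * ‖gradPhi D i t x‖ := by
        rw [Finset.sum_const, Finset.card_univ, Fintype.card_fin, nsmul_eq_mul, Nat.cast_ofNat]

end MatrixAction

/-! ## Leibniz bounds for the summand `ρ^{1/2} A v` and for `R̃ = G M Gᵀ` -/

section Leibniz

/-- **The derivative of one summand of `w_o`** (the Leibniz rule behind "Compute now
`∇w_{o,i} = Σ_k (∇Φ_i)⁻¹ b_{i,k} ∇e^{iλ_{q+1}k·Φ_i} + Σ_k ∇((∇Φ_i)⁻¹ b_{i,k}) e^{iλ_{q+1}k·Φ_i}`"): for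
smooth `f : T³ → ℝ`, `A : T³ → 𝕄`, `v : T³ → ℝ³` with `|f(x)| ≤ F`, `|∂ⱼf(x)| ≤ F'`,
`‖A(x)‖ ≤ a₀`, `‖∂ⱼA(x)‖ ≤ a₁`, `‖v(x)‖ ≤ w₀`, `‖∂ⱼv(x)‖ ≤ w₁` (nonnegative bounds),
`‖∂ⱼ(f • A v)(x)‖ ≤ 9 (F (a₀ w₁ + a₁ w₀) + F' a₀ w₀)`. [cite: BuckmasterEtAl2018, Cor. 5.8 (proof, arXiv (5.35))] -/
theorem norm_partialDeriv_smul_toEuclideanLin_le {f : (UnitAddTorus (Fin 3)) → ℝ} {A : (UnitAddTorus (Fin 3)) → (Matrix (Fin 3) (Fin 3) ℝ)} {v : (UnitAddTorus (Fin 3)) → (EuclideanSpace ℝ (Fin 3))}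
    (hf : IsSmooth f) (hA : IsSmooth A) (hv : IsSmooth v) {j : Fin 3} {x : (UnitAddTorus (Fin 3))}
    {F F' a₀ a₁ w₀ w₁ : ℝ} (hF0 : 0 ≤ F) (hF'0 : 0 ≤ F') (ha0 : 0 ≤ a₀)
    (h1 : |f x| ≤ F) (h2 : |partialDeriv j f x| ≤ F') (h3 : ‖A x‖ ≤ a₀)
    (h4 : ‖partialDeriv j A x‖ ≤ a₁) (h5 : ‖v x‖ ≤ w₀) (h6 : ‖partialDeriv j v x‖ ≤ w₁) :
    ‖partialDeriv j (fun y => f y • Matrix.toEuclideanLin (A y) (v y)) x‖ ≤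
      9 * (F * (a₀ * w₁ + a₁ * w₀) + F' * a₀ * w₀) := by
  have hg : IsSmooth (fun y => Matrix.toEuclideanLin (A y) (v y)) := isSmooth_toEuclideanLin hA hv
  have hdg : partialDeriv j (fun y => Matrix.toEuclideanLin (A y) (v y)) x =
      Matrix.toEuclideanLin (A x) (partialDeriv j v x) +
        Matrix.toEuclideanLin (partialDeriv j A x) (v x) :=
    partialDeriv_bilinear_apply (bmat.comp mtranspose) hA hv j x
  rw [partialDeriv_smul (hf.isContDiff (by simp)) (hg.isContDiff (by simp)) j x, hdg]
  have ha1 : 0 ≤ a₁ := (norm_nonneg _).trans h4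
  have hw1 : 0 ≤ w₁ := (norm_nonneg _).trans h6
  have e1 : ‖Matrix.toEuclideanLin (A x) (partialDeriv j v x)‖ ≤ 9 * a₀ * w₁ :=
    (norm_toEuclideanLin_le _ _).trans (by gcongr)
  have e2 : ‖Matrix.toEuclideanLin (partialDeriv j A x) (v x)‖ ≤ 9 * a₁ * w₀ :=
    (norm_toEuclideanLin_le _ _).trans (by gcongr)
  have e3 : ‖Matrix.toEuclideanLin (A x) (v x)‖ ≤ 9 * a₀ * w₀ :=
    (norm_toEuclideanLin_le _ _).trans (by gcongr)
  calc ‖f x • (Matrix.toEuclideanLin (A x) (partialDeriv j v x) +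
          Matrix.toEuclideanLin (partialDeriv j A x) (v x)) +
        partialDeriv j f x • Matrix.toEuclideanLin (A x) (v x)‖
      ≤ ‖f x • (Matrix.toEuclideanLin (A x) (partialDeriv j v x) +
          Matrix.toEuclideanLin (partialDeriv j A x) (v x))‖ +
        ‖partialDeriv j f x • Matrix.toEuclideanLin (A x) (v x)‖ := norm_add_le _ _
    _ ≤ F * (9 * a₀ * w₁ + 9 * a₁ * w₀) + F' * (9 * a₀ * w₀) := by
        rw [norm_smul, norm_smul, Real.norm_eq_abs, Real.norm_eq_abs]
        exact add_le_add
          (mul_le_mul h1 ((norm_add_le _ _).trans (add_le_add e1 e2)) (norm_nonneg _) hF0)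
          (mul_le_mul h2 e3 (norm_nonneg _) hF'0)
    _ = 9 * (F * (a₀ * w₁ + a₁ * w₀) + F' * a₀ * w₀) := by ring

/-- The summand `f • A v` has vanishing derivative wherever `f` vanishes to first order. [folklore] -/
theorem partialDeriv_smul_toEuclideanLin_eq_zero {f : (UnitAddTorus (Fin 3)) → ℝ} {A : (UnitAddTorus (Fin 3)) → (Matrix (Fin 3) (Fin 3) ℝ)} {v : (UnitAddTorus (Fin 3)) → (EuclideanSpace ℝ (Fin 3))}
    (hf : IsSmooth f) (hA : IsSmooth A) (hv : IsSmooth v) {j : Fin 3} {x : (UnitAddTorus (Fin 3))} (h0 : f x = 0)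
    (h1 : partialDeriv j f x = 0) :
    partialDeriv j (fun y => f y • Matrix.toEuclideanLin (A y) (v y)) x = 0 := by
  have hg : IsSmooth (fun y => Matrix.toEuclideanLin (A y) (v y)) := isSmooth_toEuclideanLin hA hv
  rw [partialDeriv_smul (hf.isContDiff (by simp)) (hg.isContDiff (by simp)) j x, h0, h1, zero_smul,
    zero_smul, add_zero]

/-- **Leibniz bound for the conjugated matrix `G M Gᵀ`** (the computation
"`‖R̃_{q,i}‖_N ≲ ‖∇Φ_i‖_N‖∇Φ_i‖₀ + ‖R_{q,i}/ρ_{q,i}‖_N`" of the proof of Prop. 5.7 at `N = 1`,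
pointwise): for smooth `G, M : T³ → 𝕄` with `‖G(x)‖ ≤ g₀`, `‖∂ⱼG(x)‖ ≤ g₁`, `‖M(x)‖ ≤ m₀`,
`‖∂ⱼM(x)‖ ≤ m₁`, `‖∂ⱼ(G M Gᵀ)(x)‖ ≤ 9 g₀ (2 m₀ g₁ + g₀ m₁)` (elementwise sup norms,
`‖AB‖ ≤ 3‖A‖‖B‖`). [cite: BuckmasterEtAl2018, Prop. 5.7 (proof, arXiv (5.24))] -/
theorem norm_partialDeriv_conj_le {G M : (UnitAddTorus (Fin 3)) → (Matrix (Fin 3) (Fin 3) ℝ)} (hG : IsSmooth G) (hM : IsSmooth M) {j : Fin 3}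
    {x : (UnitAddTorus (Fin 3))} {g₀ g₁ m₀ m₁ : ℝ} (hg0 : 0 ≤ g₀) (hm0 : 0 ≤ m₀) (h1 : ‖G x‖ ≤ g₀)
    (h2 : ‖partialDeriv j G x‖ ≤ g₁) (h3 : ‖M x‖ ≤ m₀) (h4 : ‖partialDeriv j M x‖ ≤ m₁) :
    ‖partialDeriv j (fun y => G y * M y * (G y)ᵀ) x‖ ≤ 9 * g₀ * (2 * m₀ * g₁ + g₀ * m₁) := by
  have hg1 : 0 ≤ g₁ := (norm_nonneg _).trans h2
  have hm1 : 0 ≤ m₁ := (norm_nonneg _).trans h4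
  have hGM : IsSmooth (fun y => G y * M y) := hG.matrix_mul hM
  have hGt : IsSmooth (fun y => (G y)ᵀ) := hG.comp_clm mtranspose
  -- the Leibniz expansions
  have hd1 : partialDeriv j (fun y => G y * M y * (G y)ᵀ) x =
      G x * M x * partialDeriv j (fun y => (G y)ᵀ) x +
        partialDeriv j (fun y => G y * M y) x * (G x)ᵀ :=
    partialDeriv_bilinear_apply mmul hGM hGt j x
  have hd2 : partialDeriv j (fun y => G y * M y) x =
      G x * partialDeriv j M x + partialDeriv j G x * M x :=
    partialDeriv_bilinear_apply mmul hG hM j x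
  have hd3 : partialDeriv j (fun y => (G y)ᵀ) x = (partialDeriv j G x)ᵀ :=
    partialDeriv_clm_comp hG mtranspose j x
  rw [hd1, hd2, hd3]
  -- norms
  have n1 : ‖G x * M x‖ ≤ 3 * g₀ * m₀ := (norm_matrix_mul_le _ _).trans (by gcongr)
  have n2 : ‖G x * M x * (partialDeriv j G x)ᵀ‖ ≤ 3 * (3 * g₀ * m₀) * g₁ := by
    refine (norm_matrix_mul_le _ _).trans ?_
    rw [Matrix.norm_transpose]
    gcongr
  have n3 : ‖G x * partialDeriv j M x + partialDeriv j G x * M x‖ ≤ 3 * g₀ * m₁ + 3 * g₁ * m₀ :=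
    (norm_add_le _ _).trans (add_le_add ((norm_matrix_mul_le _ _).trans (by gcongr))
      ((norm_matrix_mul_le _ _).trans (by gcongr)))
  have n4 : ‖(G x * partialDeriv j M x + partialDeriv j G x * M x) * (G x)ᵀ‖ ≤
      3 * (3 * g₀ * m₁ + 3 * g₁ * m₀) * g₀ := by
    refine (norm_matrix_mul_le _ _).trans ?_
    rw [Matrix.norm_transpose]
    gcongr
  calc ‖G x * M x * (partialDeriv j G x)ᵀ + (G x * partialDeriv j M x + partialDeriv j G x * M x) * (G x)ᵀ‖
      ≤ 3 * (3 * g₀ * m₀) * g₁ + 3 * (3 * g₀ * m₁ + 3 * g₁ * m₀) * g₀ :=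
        (norm_add_le _ _).trans (add_le_add n2 n4)
    _ = 9 * g₀ * (2 * m₀ * g₁ + g₀ * m₁) := by ring

/-- The derivative of the middle factor `M = Id - c R` of `R̃` (arXiv (5.27)):
`∂ⱼ(Id - c • ofCols R)(x) = -c • ofCols (∂ⱼR(x))`. [folklore] -/
theorem partialDeriv_one_sub_smul_ofCols {R : (UnitAddTorus (Fin 3)) → Fin 3 → (EuclideanSpace ℝ (Fin 3))} (hR : IsSmooth R) (c : ℝ) (j : Fin 3)
    (x : (UnitAddTorus (Fin 3))) :
    partialDeriv j (fun y => (1 : (Matrix (Fin 3) (Fin 3) ℝ)) - c • ofCols (R y)) x = -(c • ofCols (partialDeriv j R x)) := by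
  have hRo : IsSmooth (fun y => ofCols (R y)) := hR.comp_clm ofColsCLM
  have h1 : IsContDiff 1 (fun _ : (UnitAddTorus (Fin 3)) => (1 : (Matrix (Fin 3) (Fin 3) ℝ))) := isContDiff_const _
  have h2 : IsContDiff 1 (fun y => c • ofCols (R y)) := (hRo.isContDiff (by simp)).smul c
  rw [Torus.partialDeriv_sub_at h1 h2 j x, Torus.partialDeriv_const_apply, zero_sub,
    Torus.partialDeriv_const_smul_at (hRo.isContDiff (by simp)) c j x]
  congr 2
  exact partialDeriv_clm_comp hR ofColsCLM j x

end Leibniz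

/-! ## Two parameter inequalities -/

section Params

/-- `λ_q^α ℓ^α ≤ 1` for `a, b ≥ 1`, `β, α ≥ 0` (from (2.11) `ℓ ≤ λ_q⁻¹`). [cite: BuckmasterEtAl2018, §2.4 (2.11)] -/
theorem freq_rpow_mul_mollScale_rpow_le_one_of_nonneg {β α a b : ℝ} (ha : 1 ≤ a) (hb : 1 ≤ b)
    (hβ : 0 ≤ β) (hα : 0 ≤ α) (q : ℕ) : freq a b q ^ α * mollScale β α a b q ^ α ≤ 1 := by
  have hf := freq_pos (b := b) ha q
  have hℓ := mollScale_pos (β := β) (α := α) (b := b) ha q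
  rw [← Real.mul_rpow hf.le hℓ.le]
  refine Real.rpow_le_one (mul_nonneg hf.le hℓ.le) ?_ hα
  calc freq a b q * mollScale β α a b q ≤ freq a b q * (freq a b q)⁻¹ :=
        mul_le_mul_of_nonneg_left (mollScale_le_freq_inv ha hb hβ hα q) hf.le
    _ = 1 := mul_inv_cancel₀ hf.ne'

/-- `n_q ≤ λ_q = 2π n_q` for `a ≥ 0`. [folklore] -/
theorem Params.freqNat_le_freq (P : Params) (ha : 0 ≤ P.a) (q : ℕ) :
    (P.freqNat q : ℝ) ≤ freq P.a P.b q := by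
  rw [P.freq_eq ha q]
  have hn : 0 ≤ (P.freqNat q : ℝ) := Nat.cast_nonneg _
  nlinarith [Real.two_le_pi]

end Params

/-! ## Pointwise bounds on the ingredients of `w_o` under the standing hypotheses -/

section Pointwise

variable {P : Params} {S : Setting} {Nbar : ℕ} {Cin C₀ c₀ : ℝ} {Cη : ℕ → ℕ → ℝ}

/-- `∂ⱼρ_{q,i}^{1/2} = (∂ⱼη_i) (ρ_q/Σ∫η_j²)^{1/2}` (the second factor is a function of time only).
[cite: BuckmasterEtAl2018, §5.2 (ρ_{q,i})] -/
theorem partialDeriv_sqrtRhoI {η : ℕ → ℝ → (UnitAddTorus (Fin 3)) → ℝ} {i : ℕ} {t : ℝ} (hη : IsSmooth (η i t))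
    (j : Fin 3) (x : (UnitAddTorus (Fin 3))) :
    partialDeriv j (sqrtRhoI P S η i t) x =
      partialDeriv j (η i t) x * Real.sqrt (rhoQ P S t / etaMass P S η t) := by
  have e : sqrtRhoI P S η i t = fun y => η i t y * Real.sqrt (rhoQ P S t / etaMass P S η t) := rfl
  rw [e, partialDeriv_mul (hη.isContDiff (by simp)) (isContDiff_const _) j x,
    Torus.partialDeriv_const_apply, mul_zero, zero_add]

/-- **Lemma 5.3 at order `(0,1)`**: `|∂ⱼη_i(t,x)| ≤ max(C(0,1), 0)` on `[0,T] × T³`.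
[cite: BuckmasterEtAl2018, Lemma 5.3] -/
theorem PerturbationData.abs_partialDeriv_eta_le (𝒟 : PerturbationData P S c₀ Cη) (i : ℕ) {t : ℝ}
    (ht : t ∈ Icc 0 S.T) (j : Fin 3) (x : (UnitAddTorus (Fin 3))) :
    |partialDeriv j (𝒟.cut.η i t) x| ≤ max (Cη 0 1) 0 := by
  have h := 𝒟.cut.deriv_le i 0 1
  simp only [Function.iterate_zero, id_eq, Nat.cast_zero, neg_zero, Real.rpow_zero, mul_one] at h
  have h1 : IsContDiff 1 (𝒟.cut.η i t) := ((𝒟.cut.smooth i).isSmooth_slice ht).isContDiff (by simp)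
  have h2 := norm_partialDeriv_le_of_eContDiffHolderNorm_le h1 (le_max_right _ _)
    ((h.mono (le_max_left (Cη 0 1) 0)) t ht) j x
  rwa [Real.norm_eq_abs] at h2

/-- **`|∂ⱼρ_{q,i}^{1/2}| ≤ max(C(0,1),0) (δ_{q+1}/c₀)^{1/2}`** on `[0,T] × T³` (Lemmas 5.3, 5.4).
[cite: BuckmasterEtAl2018, Lemma 5.3, Lemma 5.4] -/
theorem PerturbationData.abs_partialDeriv_sqrtRhoI_le (H : PerturbationHypotheses P S Nbar Cin C₀)
    (𝒟 : PerturbationData P S c₀ Cη) (hc₀ : 0 < c₀) (ha : 1 ≤ P.a) {i : ℕ} {t : ℝ}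
    (ht : t ∈ Icc 0 S.T) (j : Fin 3) (x : (UnitAddTorus (Fin 3))) :
    |partialDeriv j (sqrtRhoI P S 𝒟.cut.η i t) x| ≤
      max (Cη 0 1) 0 * Real.sqrt (amp P.β P.a P.b (S.q + 1) / c₀) := by
  -- the time factor: `(ρ_q/Σ∫η_j²)^{1/2} ≤ (δ_{q+1}/c₀)^{1/2}` (Lemma 5.4 (5.15), (5.19))
  have hm : c₀ ≤ etaMass P S 𝒟.cut.η t := 𝒟.le_etaMass ht
  have hm0 : 0 < etaMass P S 𝒟.cut.η t := hc₀.trans_le hm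
  have hfac : Real.sqrt (rhoQ P S t / etaMass P S 𝒟.cut.η t) ≤
      Real.sqrt (amp P.β P.a P.b (S.q + 1) / c₀) := by
    refine Real.sqrt_le_sqrt ?_
    calc rhoQ P S t / etaMass P S 𝒟.cut.η t
        ≤ amp P.β P.a P.b (S.q + 1) / etaMass P S 𝒟.cut.η t :=
          div_le_div_of_nonneg_right (H.rhoQ_le ha ht) hm0.le
      _ ≤ amp P.β P.a P.b (S.q + 1) / c₀ := div_le_div_of_nonneg_left (amp_pos ha _).le hc₀ hm
  rw [partialDeriv_sqrtRhoI ((𝒟.cut.smooth i).isSmooth_slice ht), abs_mul,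
    abs_of_nonneg (Real.sqrt_nonneg _)]
  exact mul_le_mul (𝒟.abs_partialDeriv_eta_le i ht j x) hfac (Real.sqrt_nonneg _) (le_max_right _ _)

/-- Off the support of `η_i`, `ρ_{q,i}^{1/2}` vanishes to first order (`η_i ≥ 0` is minimal at its
zeros). [folklore] -/
theorem PerturbationData.partialDeriv_sqrtRhoI_eq_zero (𝒟 : PerturbationData P S c₀ Cη) {i : ℕ}
    {t : ℝ} (ht : t ∈ Icc 0 S.T) {x : (UnitAddTorus (Fin 3))} (hx : 𝒟.cut.η i t x = 0) (j : Fin 3) :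
    partialDeriv j (sqrtRhoI P S 𝒟.cut.η i t) x = 0 := by
  have hη : IsSmooth (𝒟.cut.η i t) := (𝒟.cut.smooth i).isSmooth_slice ht
  rw [partialDeriv_sqrtRhoI hη, partialDeriv_eq_zero_of_nonneg_of_eq_zero hη (𝒟.cut.nonneg i t) hx j,
    zero_mul]

/-- **`‖adj ∇Φ_i‖_∞ ≤ 2e^{8C_in}` on the support of `η_i`** ("`‖(∇Φ_i)⁻¹‖₀ ≤ 2` on `supp η_i`",
from `‖∇Φ_i‖_∞ ≤ e^{4C_in}` and `‖adj A‖_∞ ≤ 2‖A‖_∞²`). [cite: BuckmasterEtAl2018, Cor. 5.8 (proof, first line)] -/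
theorem PerturbationData.norm_adjugate_gradPhi_le (H : PerturbationHypotheses P S Nbar Cin C₀)
    (𝒟 : PerturbationData P S c₀ Cη) (hCin : 0 ≤ Cin) (ha : 1 ≤ P.a) (hb : 1 ≤ P.b) (hβ : 0 ≤ P.β)
    (hα : 0 ≤ P.α) {i : ℕ} {t : ℝ} (ht : t ∈ Icc 0 S.T) {x' : (UnitAddTorus (Fin 3))} (hη : 𝒟.cut.η i t x' ≠ 0) (x : (UnitAddTorus (Fin 3))) :
    ‖(gradPhi 𝒟.D i t x).adjugate‖ ≤ 2 * Real.exp (8 * Cin) := by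
  have hG : ‖gradPhi 𝒟.D i t x‖ ≤ Real.exp (4 * Cin) := 𝒟.norm_gradPhi_le H hCin ha hb hβ hα ht hη x
  refine (norm_adjugate_le _).trans ?_
  have h2 : ‖gradPhi 𝒟.D i t x‖ ^ 2 ≤ Real.exp (4 * Cin) ^ 2 := pow_le_pow_left₀ (norm_nonneg _) hG 2
  have h8 : Real.exp (4 * Cin) ^ 2 = Real.exp (8 * Cin) := by
    rw [← Real.exp_nat_mul]; ring_nf
  linarith

/-- **`‖∂ⱼ adj∇Φ_i‖ ≤ B₁` on `Ĩ_i` from a `C¹` bound on `(∇Φ_i)⁻¹`** (Prop. 5.7, arXiv (5.23), at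
`N = 1`; `(∇Φ_i)⁻¹ = adj ∇Φ_i` since `det ∇Φ_i = 1`). [cite: BuckmasterEtAl2018, Prop. 5.7 (arXiv (5.23))] -/
theorem PerturbationData.norm_partialDeriv_adjugate_gradPhi_le (H : PerturbationHypotheses P S Nbar Cin C₀)
    (𝒟 : PerturbationData P S c₀ Cη) (ha : 1 ≤ P.a) {i : ℕ} {t : ℝ} (ht : t ∈ Icc 0 S.T) {x' : (UnitAddTorus (Fin 3))}
    (hη : 𝒟.cut.η i t x' ≠ 0) {B₁ : ℝ} (hB₁ : 0 ≤ B₁)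
    (hGinv : HolderSupOnLE (tildeInterval S.T (P.τ S.q) i) (fun s y => (gradPhi 𝒟.D i s y)⁻¹) 1 0 B₁)
    (j : Fin 3) (x : (UnitAddTorus (Fin 3))) :
    ‖partialDeriv j (fun y => (gradPhi 𝒟.D i t y).adjugate) x‖ ≤ B₁ := by
  have htI : t ∈ tildeInterval S.T (P.τ S.q) i := 𝒟.cut.mem_tildeInterval ht hη
  have hDt : IsSmooth (𝒟.D i t) := (𝒟.flow i).smooth.isSmooth_slice ht
  have hinv : (fun y => (gradPhi 𝒟.D i t y)⁻¹) = fun y => (gradPhi 𝒟.D i t y).adjugate := by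
    funext y
    rw [Matrix.inv_def, 𝒟.det_gradPhi_eq_one H ha i ht y, Ring.inverse_one, one_smul]
  have h : Torus.eContDiffHolderNorm 1 0 (fun y => (gradPhi 𝒟.D i t y).adjugate) ≤ ENNReal.ofReal B₁ := by
    rw [← hinv]
    exact hGinv t htI
  have hadj : IsContDiff 1 (fun y => (gradPhi 𝒟.D i t y).adjugate) :=
    (isSmooth_adjugate_of_entries fun a b => isSmooth_gradPhi_entry hDt a b).isContDiff (by simp)
  exact norm_partialDeriv_le_of_eContDiffHolderNorm_le hadj hB₁ h j x

/-- **`‖∂ⱼ∇Φ_i‖ ≤ B₁` on `Ĩ_i` from a `C¹` bound on `∇Φ_i`** (Prop. 5.7, arXiv (5.23), at `N = 1`).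
[cite: BuckmasterEtAl2018, Prop. 5.7 (arXiv (5.23))] -/
theorem PerturbationData.norm_partialDeriv_gradPhi_le (𝒟 : PerturbationData P S c₀ Cη) {i : ℕ}
    {t : ℝ} (ht : t ∈ Icc 0 S.T) {x' : (UnitAddTorus (Fin 3))} (hη : 𝒟.cut.η i t x' ≠ 0) {B₁ : ℝ} (hB₁ : 0 ≤ B₁)
    (hG1 : HolderSupOnLE (tildeInterval S.T (P.τ S.q) i) (fun s y => gradPhi 𝒟.D i s y) 1 0 B₁)
    (j : Fin 3) (x : (UnitAddTorus (Fin 3))) :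
    ‖partialDeriv j (gradPhi 𝒟.D i t) x‖ ≤ B₁ := by
  have htI : t ∈ tildeInterval S.T (P.τ S.q) i := 𝒟.cut.mem_tildeInterval ht hη
  have hDt : IsSmooth (𝒟.D i t) := (𝒟.flow i).smooth.isSmooth_slice ht
  have h : Torus.eContDiffHolderNorm 1 0 (gradPhi 𝒟.D i t) ≤ ENNReal.ofReal B₁ := hG1 t htI
  exact norm_partialDeriv_le_of_eContDiffHolderNorm_le (isContDiff_gradPhi hDt 1) hB₁ h j x

/-- **The middle factor `Id - (Σ∫η_j²/ρ_q) R̊̄_q` of `R̃_{q,i}` is bounded by `1 + 8C_in`** (arXiv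
(5.28) at `N = 0`: `‖R_{q,i}/ρ_{q,i}‖₀ ≲ 1 + λ_q^α δ_{q+1}⁻¹‖R̊̄_q‖₀`, with (2.20) and `λ_q^αℓ^α ≤ 1`).
[cite: BuckmasterEtAl2018, Prop. 5.7 (proof, arXiv (5.28))] -/
theorem PerturbationData.norm_middle_le (H : PerturbationHypotheses P S Nbar Cin C₀)
    (𝒟 : PerturbationData P S c₀ Cη) (hCin : 0 ≤ Cin) (ha : 1 ≤ P.a) (hb : 1 ≤ P.b) (hβ : 0 ≤ P.β)
    (hα : 0 ≤ P.α)
    (h4 : 4 * amp P.β P.a P.b (S.q + 2) ≤ amp P.β P.a P.b (S.q + 1) * freq P.a P.b S.q ^ (-P.α))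
    {t : ℝ} (ht : t ∈ Icc 0 S.T) (x : (UnitAddTorus (Fin 3))) :
    ‖(1 : (Matrix (Fin 3) (Fin 3) ℝ)) - (etaMass P S 𝒟.cut.η t / rhoQ P S t) • ofCols (S.Rbar t x)‖ ≤ 1 + 8 * Cin := by
  obtain ⟨hc0, hc⟩ := 𝒟.etaMass_div_rhoQ_le H ha h4 ht
  have hδ : 0 < amp P.β P.a P.b (S.q + 1) := amp_pos ha _
  have hR := H.norm_ofCols_Rbar_le hCin ha ht x
  have hcR : ‖(etaMass P S 𝒟.cut.η t / rhoQ P S t) • ofCols (S.Rbar t x)‖ ≤ 8 * Cin := by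
    rw [norm_smul, Real.norm_eq_abs, abs_of_nonneg hc0]
    have hprod := freq_rpow_mul_mollScale_rpow_le_one_of_nonneg (β := P.β) ha hb hβ hα S.q
    calc etaMass P S 𝒟.cut.η t / rhoQ P S t * ‖ofCols (S.Rbar t x)‖
        ≤ (8 * freq P.a P.b S.q ^ P.α / amp P.β P.a P.b (S.q + 1)) *
            (Cin * (amp P.β P.a P.b (S.q + 1) * mollScale P.β P.α P.a P.b S.q ^ P.α)) :=
          mul_le_mul hc hR (norm_nonneg _)
            (div_nonneg (mul_nonneg (by norm_num) (Real.rpow_nonneg (freq_pos ha _).le _)) hδ.le)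
      _ = 8 * Cin * (freq P.a P.b S.q ^ P.α * mollScale P.β P.α P.a P.b S.q ^ P.α) := by
          field_simp
      _ ≤ 8 * Cin * 1 := mul_le_mul_of_nonneg_left hprod (by positivity)
      _ = 8 * Cin := mul_one _
  exact (norm_sub_le _ _).trans (add_le_add norm_one_matrix_le hcR)

/-- **The derivative of the middle factor**: `‖∂ⱼ(Id - (Σ∫η_j²/ρ_q) R̊̄_q)(t,x)‖ ≤ 8C_in ℓ⁻¹`
(arXiv (5.28) at `N = 1`: `λ_q^α δ_{q+1}⁻¹ ‖R̊̄_q‖_1 ≲ ℓ^{-1+α}λ_q^α ≲ ℓ⁻¹`, with (2.20) at `N = 1`).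
[cite: BuckmasterEtAl2018, Prop. 5.7 (proof, arXiv (5.28))] -/
theorem PerturbationData.norm_partialDeriv_middle_le (H : PerturbationHypotheses P S Nbar Cin C₀)
    (𝒟 : PerturbationData P S c₀ Cη) (hN : 1 ≤ Nbar) (hCin : 0 ≤ Cin) (ha : 1 ≤ P.a) (hb : 1 ≤ P.b)
    (hβ : 0 ≤ P.β) (hα : 0 ≤ P.α)
    (h4 : 4 * amp P.β P.a P.b (S.q + 2) ≤ amp P.β P.a P.b (S.q + 1) * freq P.a P.b S.q ^ (-P.α))
    {t : ℝ} (ht : t ∈ Icc 0 S.T) (j : Fin 3) (x : (UnitAddTorus (Fin 3))) :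
    ‖partialDeriv j (fun y => (1 : (Matrix (Fin 3) (Fin 3) ℝ)) - (etaMass P S 𝒟.cut.η t / rhoQ P S t) • ofCols (S.Rbar t y)) x‖ ≤
      8 * Cin * (mollScale P.β P.α P.a P.b S.q)⁻¹ := by
  obtain ⟨hc0, hc⟩ := 𝒟.etaMass_div_rhoQ_le H ha h4 ht
  have hδ : 0 < amp P.β P.a P.b (S.q + 1) := amp_pos ha _
  have hℓ : 0 < mollScale P.β P.α P.a P.b S.q := mollScale_pos ha _
  have hR : IsSmooth (S.Rbar t) := H.eulerReynolds.smooth_stress.isSmooth_slice ht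
  -- (2.20) at `N = 1`, pointwise
  have hB : 0 ≤ Cin * (amp P.β P.a P.b (S.q + 1) *
      mollScale P.β P.α P.a P.b S.q ^ (-((1 : ℕ) : ℝ) + P.α)) :=
    mul_nonneg hCin (mul_nonneg hδ.le (Real.rpow_nonneg hℓ.le _))
  have hdR : ‖partialDeriv j (S.Rbar t) x‖ ≤
      Cin * (amp P.β P.a P.b (S.q + 1) * mollScale P.β P.α P.a P.b S.q ^ (-((1 : ℕ) : ℝ) + P.α)) :=
    norm_partialDeriv_le_of_eContDiffHolderNorm_le (hR.isContDiff (by simp)) hB (H.stress 1 hN t ht) j x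
  have hexp : mollScale P.β P.α P.a P.b S.q ^ (-((1 : ℕ) : ℝ) + P.α) =
      mollScale P.β P.α P.a P.b S.q ^ P.α * (mollScale P.β P.α P.a P.b S.q)⁻¹ := by
    rw [Nat.cast_one, show -(1 : ℝ) + P.α = P.α + (-1) by ring, Real.rpow_add hℓ, Real.rpow_neg_one]
  rw [hexp] at hdR
  have hprod := freq_rpow_mul_mollScale_rpow_le_one_of_nonneg (β := P.β) ha hb hβ hα S.q
  rw [partialDeriv_one_sub_smul_ofCols hR _ j x, norm_neg, norm_smul, Real.norm_eq_abs,
    abs_of_nonneg hc0]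
  calc etaMass P S 𝒟.cut.η t / rhoQ P S t * ‖ofCols (partialDeriv j (S.Rbar t) x)‖
      ≤ (8 * freq P.a P.b S.q ^ P.α / amp P.β P.a P.b (S.q + 1)) *
          (Cin * (amp P.β P.a P.b (S.q + 1) *
            (mollScale P.β P.α P.a P.b S.q ^ P.α * (mollScale P.β P.α P.a P.b S.q)⁻¹))) :=
        mul_le_mul hc ((norm_ofCols_le _).trans hdR) (norm_nonneg _)
          (div_nonneg (mul_nonneg (by norm_num) (Real.rpow_nonneg (freq_pos ha _).le _)) hδ.le)
    _ = 8 * Cin * (freq P.a P.b S.q ^ P.α * mollScale P.β P.α P.a P.b S.q ^ P.α) *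
          (mollScale P.β P.α P.a P.b S.q)⁻¹ := by
        field_simp
    _ ≤ 8 * Cin * 1 * (mollScale P.β P.α P.a P.b S.q)⁻¹ := by gcongr
    _ = 8 * Cin * (mollScale P.β P.α P.a P.b S.q)⁻¹ := by rw [mul_one]

/-- **`‖∂ⱼR̃_{q,i}‖ ≲ ℓ⁻¹` on the support of `η_i`** (Prop. 5.7, arXiv (5.24), at `N = 1`:
"`‖R̃_{q,i}‖_N ≲ ‖∇Φ_i‖_N‖∇Φ_i‖₀ + ‖R_{q,i}/ρ_{q,i}‖_N`"), with the explicit constant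
`9e^{4C_in}(2(1+8C_in)B₁ + 8C_in e^{4C_in} ℓ⁻¹)` in terms of a `C¹` bound `B₁` on `∇Φ_i` over `Ĩ_i`.
[cite: BuckmasterEtAl2018, Prop. 5.7 (arXiv (5.24))] -/
theorem PerturbationData.norm_partialDeriv_tildeR_le (H : PerturbationHypotheses P S Nbar Cin C₀)
    (𝒟 : PerturbationData P S c₀ Cη) (hN : 1 ≤ Nbar) (hCin : 0 ≤ Cin) (ha : 1 ≤ P.a) (hb : 1 ≤ P.b)
    (hβ : 0 ≤ P.β) (hα : 0 ≤ P.α)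
    (h4 : 4 * amp P.β P.a P.b (S.q + 2) ≤ amp P.β P.a P.b (S.q + 1) * freq P.a P.b S.q ^ (-P.α))
    {i : ℕ} {t : ℝ} (ht : t ∈ Icc 0 S.T) {x' : (UnitAddTorus (Fin 3))} (hη : 𝒟.cut.η i t x' ≠ 0) {B₁ : ℝ} (hB₁ : 0 ≤ B₁)
    (hG1 : HolderSupOnLE (tildeInterval S.T (P.τ S.q) i) (fun s y => gradPhi 𝒟.D i s y) 1 0 B₁)
    (j : Fin 3) (x : (UnitAddTorus (Fin 3))) :
    ‖partialDeriv j (tildeR P S 𝒟.cut.η 𝒟.D i t) x‖ ≤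
      9 * Real.exp (4 * Cin) * (2 * (1 + 8 * Cin) * B₁ +
        Real.exp (4 * Cin) * (8 * Cin * (mollScale P.β P.α P.a P.b S.q)⁻¹)) := by
  have hDt : IsSmooth (𝒟.D i t) := (𝒟.flow i).smooth.isSmooth_slice ht
  have hR : IsSmooth (S.Rbar t) := H.eulerReynolds.smooth_stress.isSmooth_slice ht
  have hG : IsSmooth (gradPhi 𝒟.D i t) :=
    isSmooth_matrix_of_entries fun a b => isSmooth_gradPhi_entry hDt a b
  set c : ℝ := etaMass P S 𝒟.cut.η t / rhoQ P S t with hc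
  have hM : IsSmooth (fun y => (1 : (Matrix (Fin 3) (Fin 3) ℝ)) - c • ofCols (S.Rbar t y)) :=
    (isSmooth_const (1 : (Matrix (Fin 3) (Fin 3) ℝ))).sub ((hR.comp_clm ofColsCLM).smul c)
  have e : tildeR P S 𝒟.cut.η 𝒟.D i t =
      fun y => gradPhi 𝒟.D i t y * ((1 : (Matrix (Fin 3) (Fin 3) ℝ)) - c • ofCols (S.Rbar t y)) * (gradPhi 𝒟.D i t y)ᵀ := rfl
  rw [e]
  have hCin8 : 0 ≤ 1 + 8 * Cin := by positivity
  exact norm_partialDeriv_conj_le hG hM (Real.exp_pos _).le hCin8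
    (𝒟.norm_gradPhi_le H hCin ha hb hβ hα ht hη x) (𝒟.norm_partialDeriv_gradPhi_le ht hη hB₁ hG1 j x)
    (𝒟.norm_middle_le H hCin ha hb hβ hα h4 ht x)
    (𝒟.norm_partialDeriv_middle_le H hN hCin ha hb hβ hα h4 ht j x)

/-- **The derivative of the Mikado factor `W(R̃_{q,i}, n_{q+1}Φ_i)`** (the chain rule (5.34) plus
the slow derivative through the matrix argument): if `‖D¹W‖ ≤ C_W` on `B̄(0, ρ) × ℝ³` with
`R̃_{q,i}(t,x) ∈ B̄(0,ρ)` and `‖∂ⱼR̃_{q,i}(t,x)‖ ≤ R₁`, then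
`‖∂ⱼ[W(R̃_{q,i}, n_{q+1}Φ_i)](t,x)‖ ≤ C_W (R₁ + 3 n_{q+1} e^{4C_in})` (`‖eⱼ + ∂ⱼD_i‖ ≤ 3‖∇Φ_i‖_∞`).
[cite: BuckmasterEtAl2018, Cor. 5.8 (proof, arXiv (5.34))] -/
theorem PerturbationData.norm_partialDeriv_mikadoW_le (H : PerturbationHypotheses P S Nbar Cin C₀)
    (𝒟 : PerturbationData P S c₀ Cη) (𝔚 : MikadoDatum mikadoRadius) (hCin : 0 ≤ Cin) (ha : 1 ≤ P.a)
    (hb : 1 ≤ P.b) (hβ : 0 ≤ P.β) (hα : 0 ≤ P.α) (hρ : ∀ s ∈ Icc 0 S.T, rhoQ P S s ≠ 0)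
    {i : ℕ} {t : ℝ} (ht : t ∈ Icc 0 S.T) {x' : (UnitAddTorus (Fin 3))} (hη : 𝒟.cut.η i t x' ≠ 0) {ρ CW R₁ : ℝ}
    (hCW0 : 0 ≤ CW)
    (hCW : ∀ R ∈ Metric.closedBall (0 : (Matrix (Fin 3) (Fin 3) ℝ)) ρ, ∀ ξ : (EuclideanSpace ℝ (Fin 3)), ‖iteratedFDeriv ℝ 1 (mikadoLift 𝔚.W) (R, ξ)‖ ≤ CW)
    {j : Fin 3} {x : (UnitAddTorus (Fin 3))} (hRt : tildeR P S 𝒟.cut.η 𝒟.D i t x ∈ Metric.closedBall (0 : (Matrix (Fin 3) (Fin 3) ℝ)) ρ)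
    (hR1 : ‖partialDeriv j (tildeR P S 𝒟.cut.η 𝒟.D i t) x‖ ≤ R₁) :
    ‖partialDeriv j (fun y => 𝔚.W (tildeR P S 𝒟.cut.η 𝒟.D i t y)
        (P.freqNat (S.q + 1) • phiPoint 𝒟.D i t y)) x‖ ≤
      CW * (R₁ + P.freqNat (S.q + 1) * (3 * Real.exp (4 * Cin))) := by
  have hDt : IsSmooth (𝒟.D i t) := (𝒟.flow i).smooth.isSmooth_slice ht
  have hRm : IsSmooth (tildeR P S 𝒟.cut.η 𝒟.D i t) :=
    isSmooth_matrix_of_entries fun a b =>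
      (isSmoothSpaceTimeOn_tildeR H.pos_T H.profile.smooth H.eulerReynolds.smooth_velocity
        H.eulerReynolds.smooth_stress 𝒟.cut.smooth (fun k => (𝒟.flow k).smooth) hρ i a b).isSmooth_slice ht
  have h := norm_partialDeriv_mikado_comp_le (V := 𝔚.W) 𝔚.smooth_W hRm hDt (P.freqNat (S.q + 1))
    hCW0 (fun ξ => hCW _ hRt ξ) j
  refine h.trans (mul_le_mul_of_nonneg_left (max_le ?_ ?_) hCW0)
  · exact hR1.trans (le_add_of_nonneg_right (by positivity))
  · refine le_add_of_nonneg_of_le ((norm_nonneg _).trans hR1) ?_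
    exact mul_le_mul_of_nonneg_left ((norm_single_add_partialDeriv_le 𝒟.D i t x j).trans
      (mul_le_mul_of_nonneg_left (𝒟.norm_gradPhi_le H hCin ha hb hβ hα ht hη x) (by norm_num)))
      (Nat.cast_nonneg _)

/-- **The derivative bound on `w_o` at fixed parameters** (the heart of arXiv (5.35)
`‖∇w_o‖₀ ≤ (M/16)δ_{q+1}^{1/2}λ_{q+1} + C̄ δ_{q+1}^{1/2} ℓ⁻¹`, with unspecified constants): under the
standing hypotheses with `N̄ ≥ 1`, `C_in ≥ 0`, `c₀ > 0`, `a ≥ 1`, `4δ_{q+2} ≤ δ_{q+1}λ_q^{-α}`, given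
bounds `K_W` on `W` and `C_W` on `D¹W` over the ball `‖R‖_∞ ≤ 9e^{8C_in}(1 + 8C_in)` (Remark 5.2) and
a common `C¹` bound `B₁` on `∇Φ_i`, `(∇Φ_i)⁻¹` over `Ĩ_i` (Prop. 5.7 (5.23)), every first spatial
derivative of `w_o` is bounded on `[0,T] × T³` by
`9 (δ_{q+1}/c₀)^{1/2} [2e^{8C_in}(C_W(9e^{4C_in}(2(1+8C_in)B₁ + 8C_in e^{4C_in}ℓ⁻¹) + 3n_{q+1}e^{4C_in})) + B₁K_W + max(C(0,1),0)·2e^{8C_in}K_W]`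
— the sum over `i` costing nothing, at most one cut-off being active at each point (and
`∂ⱼw_{o,i} = 0` off `supp η_i`). [cite: BuckmasterEtAl2018, Cor. 5.8 (proof, arXiv (5.35))] -/
theorem PerturbationData.norm_partialDeriv_principalPart_le (H : PerturbationHypotheses P S Nbar Cin C₀)
    (𝒟 : PerturbationData P S c₀ Cη) (𝔚 : MikadoDatum mikadoRadius) (hN : 1 ≤ Nbar) (hc₀ : 0 < c₀)
    (hCin : 0 ≤ Cin) (ha : 1 ≤ P.a) (hb : 1 ≤ P.b) (hβ : 0 ≤ P.β) (hα : 0 ≤ P.α)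
    (h4 : 4 * amp P.β P.a P.b (S.q + 2) ≤ amp P.β P.a P.b (S.q + 1) * freq P.a P.b S.q ^ (-P.α))
    {KW CW B₁ : ℝ} (hKW0 : 0 ≤ KW)
    (hKW : ∀ R ∈ Metric.closedBall (0 : (Matrix (Fin 3) (Fin 3) ℝ)) (9 * Real.exp (8 * Cin) * (1 + 8 * Cin)),
      ∀ ξ : (UnitAddTorus (Fin 3)), ‖𝔚.W R ξ‖ ≤ KW)
    (hCW0 : 0 ≤ CW)
    (hCW : ∀ R ∈ Metric.closedBall (0 : (Matrix (Fin 3) (Fin 3) ℝ)) (9 * Real.exp (8 * Cin) * (1 + 8 * Cin)),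
      ∀ ξ : (EuclideanSpace ℝ (Fin 3)), ‖iteratedFDeriv ℝ 1 (mikadoLift 𝔚.W) (R, ξ)‖ ≤ CW)
    (hB₁ : 0 ≤ B₁)
    (hG1 : ∀ i, HolderSupOnLE (tildeInterval S.T (P.τ S.q) i) (fun s y => gradPhi 𝒟.D i s y) 1 0 B₁)
    (hGinv : ∀ i, HolderSupOnLE (tildeInterval S.T (P.τ S.q) i)
      (fun s y => (gradPhi 𝒟.D i s y)⁻¹) 1 0 B₁)
    {t : ℝ} (ht : t ∈ Icc 0 S.T) (j : Fin 3) (x : (UnitAddTorus (Fin 3))) :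
    ‖partialDeriv j (principalPart P S 𝔚 𝒟.cut.η 𝒟.D t) x‖ ≤
      9 * Real.sqrt (amp P.β P.a P.b (S.q + 1) / c₀) *
        (2 * Real.exp (4 * Cin) ^ 2 *
            (CW * (9 * Real.exp (4 * Cin) * (2 * (1 + 8 * Cin) * B₁ +
              Real.exp (4 * Cin) * (8 * Cin * (mollScale P.β P.α P.a P.b S.q)⁻¹)) +
              P.freqNat (S.q + 1) * (3 * Real.exp (4 * Cin)))) +
          B₁ * KW + max (Cη 0 1) 0 * (2 * Real.exp (4 * Cin) ^ 2) * KW) := by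
  -- `ρ_q > 0`, smooth data, smooth factors of the summands at time `t`
  have hρpos : ∀ s ∈ Icc 0 S.T, 0 < rhoQ P S s := fun s hs =>
    lt_of_lt_of_le (div_pos (mul_pos (amp_pos ha _) (Real.rpow_pos_of_pos (freq_pos ha _) _))
      (by norm_num)) (H.le_rhoQ h4 hs)
  have hSD : SmoothData P S 𝒟.cut.η 𝒟.D := H.toSmoothData hc₀ 𝒟 hρpos
  have hf : ∀ i, IsSmooth (sqrtRhoI P S 𝒟.cut.η i t) := fun i => (hSD.sqrtRhoI i).isSmooth_slice ht
  have hA : ∀ i, IsSmooth (fun y => (gradPhi 𝒟.D i t y).adjugate) := fun i =>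
    isSmooth_adjugate_of_entries fun a b =>
      isSmooth_gradPhi_entry ((𝒟.flow i).smooth.isSmooth_slice ht) a b
  have hv : ∀ i, IsSmooth (fun y => 𝔚.W (tildeR P S 𝒟.cut.η 𝒟.D i t y)
      (P.freqNat (S.q + 1) • phiPoint 𝒟.D i t y)) := fun i => (hSD.mikadoW 𝔚 i).isSmooth_slice ht
  have hs : ∀ i, IsSmooth (principalSummand P S 𝔚 𝒟.cut.η 𝒟.D i t) := fun i =>
    (hf i).smul' (isSmooth_toEuclideanLin (hA i) (hv i))
  -- the bound is nonnegative
  set B : ℝ := 9 * Real.sqrt (amp P.β P.a P.b (S.q + 1) / c₀) *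
        (2 * Real.exp (4 * Cin) ^ 2 *
            (CW * (9 * Real.exp (4 * Cin) * (2 * (1 + 8 * Cin) * B₁ +
              Real.exp (4 * Cin) * (8 * Cin * (mollScale P.β P.α P.a P.b S.q)⁻¹)) +
              P.freqNat (S.q + 1) * (3 * Real.exp (4 * Cin)))) +
          B₁ * KW + max (Cη 0 1) 0 * (2 * Real.exp (4 * Cin) ^ 2) * KW) with hB
  have hℓ : 0 < mollScale P.β P.α P.a P.b S.q := mollScale_pos ha _
  have hCη0 : 0 ≤ max (Cη 0 1) 0 := le_max_right _ _
  have hB0 : 0 ≤ B := by positivity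
  -- vanishing of `∂ⱼ w_{o,i}` off `supp η_i`
  have hzero : ∀ i, 𝒟.cut.η i t x = 0 → partialDeriv j (principalSummand P S 𝔚 𝒟.cut.η 𝒟.D i t) x = 0 :=
    fun i hi => partialDeriv_smul_toEuclideanLin_eq_zero (hf i) (hA i) (hv i)
      (by rw [sqrtRhoI, hi, zero_mul]) (𝒟.partialDeriv_sqrtRhoI_eq_zero ht hi j)
  have e : principalPart P S 𝔚 𝒟.cut.η 𝒟.D t = fun y =>
      ∑ i ∈ Finset.range (cutoffCount S.T (P.τ S.q)), principalSummand P S 𝔚 𝒟.cut.η 𝒟.D i t y := rfl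
  rw [e, partialDeriv_finset_sum _ (fun i _ => (hs i).isContDiff (by simp)) j x]
  refine 𝒟.cut.norm_sum_le t x hB0 hzero (fun i => ?_) _
  by_cases hi : 𝒟.cut.η i t x = 0
  · rw [hzero i hi, norm_zero]
    exact hB0
  · -- the bounds on the three factors at `(t, x)`, where `η_i(t,x) ≠ 0`
    have hRt : tildeR P S 𝒟.cut.η 𝒟.D i t x ∈
        Metric.closedBall (0 : (Matrix (Fin 3) (Fin 3) ℝ)) (9 * Real.exp (8 * Cin) * (1 + 8 * Cin)) := by
      rw [Metric.mem_closedBall, dist_zero_right]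
      exact 𝒟.norm_tildeR_le H hCin ha hb hβ hα h4 ht hi x
    have h1 := 𝒟.abs_sqrtRhoI_le H hc₀ ha ht i x
    have h2 := 𝒟.abs_partialDeriv_sqrtRhoI_le H hc₀ ha (i := i) ht j x
    have h3 : ‖(gradPhi 𝒟.D i t x).adjugate‖ ≤ 2 * Real.exp (4 * Cin) ^ 2 :=
      (norm_adjugate_le _).trans (mul_le_mul_of_nonneg_left
        (pow_le_pow_left₀ (norm_nonneg _) (𝒟.norm_gradPhi_le H hCin ha hb hβ hα ht hi x) 2)
        (by norm_num))
    have h4' := 𝒟.norm_partialDeriv_adjugate_gradPhi_le H ha ht hi hB₁ (hGinv i) j x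
    have h5 : ‖𝔚.W (tildeR P S 𝒟.cut.η 𝒟.D i t x) (P.freqNat (S.q + 1) • phiPoint 𝒟.D i t x)‖ ≤ KW :=
      hKW _ hRt _
    have hR1 := 𝒟.norm_partialDeriv_tildeR_le H hN hCin ha hb hβ hα h4 ht hi hB₁ (hG1 i) j x
    have h6 := 𝒟.norm_partialDeriv_mikadoW_le H 𝔚 hCin ha hb hβ hα (fun s hs => (hρpos s hs).ne')
      ht hi hCW0 hCW hRt hR1
    refine (norm_partialDeriv_smul_toEuclideanLin_le (hf i) (hA i) (hv i) (Real.sqrt_nonneg _)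
      (mul_nonneg hCη0 (Real.sqrt_nonneg _)) (by positivity) h1 h2 h3 h4' h5 h6).trans (le_of_eq ?_)
    rw [hB]
    ring

end Pointwise

/-! ## Proof of Cor. 5.8, arXiv (5.29) -/

section Assembly

/-- **Cor. 5.8, the principal part, holds** (BDSV arXiv (5.29):
`‖w_o‖₀ + λ_{q+1}⁻¹‖w_o‖₁ ≤ (M/4)δ_{q+1}^{1/2}` for `a` sufficiently large — here with an existential
constant along the common prefix, as transcribed in `BDSV.principalPartBound`). Proof as printed:
the sup half is `BDSV.PerturbationData.norm_principalPart_le` (`‖(∇Φ_i)⁻¹‖₀ ≤ 2` on `supp η_i`,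
disjoint supports); for the derivative half, `BDSV.PerturbationData.norm_partialDeriv_principalPart_le`
(Leibniz and chain rules, Prop. 5.7 at `N = 1` through the proved `BDSV.gradPhiBound_holds`,
Lemma 5.3, Lemma 5.4, Remark 5.2) gives `‖∇w_o‖₀ ≲ δ_{q+1}^{1/2}(ℓ⁻¹ + n_{q+1} + 1)`, and (6.6)
`ℓ⁻¹ ≤ λ_{q+1}` (for `3α < 2(1-β)(b-1)`, `a` large), `n_{q+1} ≤ λ_{q+1}`, `1 ≤ λ_{q+1}` conclude.
Thresholds: `α < min(α₀(5.23), βb(b-1), (1-β)(b-1)/3)`, `N̄ = max(N̄(5.23), 1)`, `a` beyond the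
thresholds of (5.23), of `4δ_{q+2} ≤ δ_{q+1}λ_q^{-α}` and of (6.6).
[cite: BuckmasterEtAl2018, Cor. 5.8 (arXiv (5.29))] -/
theorem principalPartBound_holds : principalPartBound := by
  intro 𝔚 c₀ hc₀ Cη β hβ hβ3 b hb1 hb2
  -- Prop. 5.7 (5.23), proved in the tree
  obtain ⟨αG, hαG, hG⟩ := gradPhiBound_holds c₀ hc₀ Cη β hβ hβ3 b hb1 hb2
  have hb0 : (0 : ℝ) < b := by linarith
  have hbm : (0 : ℝ) < b - 1 := by linarith
  have h1β : (0 : ℝ) < 1 - β := by linarith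
  refine ⟨min αG (min (β * b * (b - 1)) ((1 - β) * (b - 1) / 3)),
    lt_min hαG (lt_min (mul_pos (mul_pos hβ hb0) hbm) (div_pos (mul_pos h1β hbm) (by norm_num))),
    fun α hα hαlt => ?_⟩
  have hαG' : α < αG := lt_of_lt_of_le hαlt (min_le_left _ _)
  have hαb : α < 2 * β * b * (b - 1) := by
    have := lt_of_lt_of_le hαlt ((min_le_right _ _).trans (min_le_left _ _))
    nlinarith [mul_pos hβ hb0]
  have hα66 : 3 * α < 2 * (1 - β) * (b - 1) := by
    have := lt_of_lt_of_le hαlt ((min_le_right _ _).trans (min_le_right _ _))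
    nlinarith [mul_pos h1β hbm]
  obtain ⟨NG, hG⟩ := hG α hα hαG' 1
  refine ⟨max NG 1, fun Cin C₀ => ?_⟩
  obtain ⟨C₁, aG, haG, hG⟩ := hG Cin C₀
  -- the constants
  set Cp : ℝ := max Cin 0 with hCp
  have hCp0 : 0 ≤ Cp := le_max_right _ _
  obtain ⟨KW, hKW0, hKW⟩ := 𝔚.exists_bound_W
    (isCompact_closedBall (0 : (Matrix (Fin 3) (Fin 3) ℝ)) (9 * Real.exp (8 * Cp) * (1 + 8 * Cp)))
  obtain ⟨CW, hCW0, hCW⟩ := exists_forall_norm_iteratedFDeriv_mikadoLift_le 𝔚.contDiff_mikadoLift_W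
    (isCompact_closedBall (0 : (Matrix (Fin 3) (Fin 3) ℝ)) (9 * Real.exp (8 * Cp) * (1 + 8 * Cp))) 1
  set C₁p : ℝ := max C₁ 0 with hC₁p
  have hC₁p0 : 0 ≤ C₁p := le_max_right _ _
  have hCη0 : 0 ≤ max (Cη 0 1) 0 := le_max_right _ _
  set E : ℝ := Real.exp (4 * Cp) with hE
  have hE0 : 0 ≤ E := (Real.exp_pos _).le
  -- the coefficients of `ℓ⁻¹`, of `n_{q+1}` and of `1` in the derivative bound, and the two constants
  set A₁ : ℝ := 2 * E ^ 2 * (CW * (9 * E * (2 * (1 + 8 * Cp) * C₁p + E * (8 * Cp)))) + C₁p * KW with hA₁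
  set A₂ : ℝ := 2 * E ^ 2 * (CW * (3 * E)) with hA₂
  set A₃ : ℝ := max (Cη 0 1) 0 * (2 * E ^ 2) * KW with hA₃
  have hA₁0 : 0 ≤ A₁ := by positivity
  have hA₂0 : 0 ≤ A₂ := by positivity
  have hA₃0 : 0 ≤ A₃ := by positivity
  set Ko : ℝ := 18 * Real.exp (8 * Cp) * KW / Real.sqrt c₀ with hKo
  set Kd : ℝ := 9 / Real.sqrt c₀ * (A₁ + A₂ + A₃) with hKd
  obtain ⟨a₄, ha₄, h4⟩ := exists_threshold_four_amp hb1 hαb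
  obtain ⟨a₆, ha₆, h66⟩ := exists_threshold_mollScale_inv_mul_freq_inv_le_one hb1.le hα66
  refine ⟨max Ko Kd, max aG (max a₄ a₆), lt_max_of_lt_left haG, fun a ha S H 𝒟 => ?_⟩
  have haG' : aG ≤ a := (le_max_left _ _).trans ha
  have ha₄' : a₄ ≤ a := ((le_max_left _ _).trans (le_max_right _ _)).trans ha
  have ha₆' : a₆ ≤ a := ((le_max_right _ _).trans (le_max_right _ _)).trans ha
  have ha1 : (1 : ℝ) ≤ a := haG.le.trans haG'
  have h4q := h4 a ha₄' S.q
  -- the standing hypotheses at the two orders used, with `C_in` replaced by `max C_in 0`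
  have HG : PerturbationHypotheses ⟨β, α, a, b⟩ S NG Cin C₀ := H.of_le (le_max_left _ _)
  have H1 : PerturbationHypotheses ⟨β, α, a, b⟩ S 1 Cp C₀ :=
    (H.of_le (le_max_right _ _)).mono_const ha1 (le_max_left _ _)
  -- (5.23) at `N = 1`, with the constant `C₁p ℓ⁻¹`
  have hℓ : 0 < mollScale β α a b S.q := mollScale_pos ha1 _
  have hmono : C₁ * mollScale β α a b S.q ^ (-((1 : ℕ) : ℝ)) ≤ C₁p * (mollScale β α a b S.q)⁻¹ := by
    rw [Nat.cast_one, Real.rpow_neg_one]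
    exact mul_le_mul_of_nonneg_right (le_max_left _ _) (inv_nonneg.2 hℓ.le)
  have hG1 : ∀ i, HolderSupOnLE (tildeInterval S.T (Params.τ ⟨β, α, a, b⟩ S.q) i)
      (fun s y => gradPhi 𝒟.D i s y) 1 0 (C₁p * (mollScale β α a b S.q)⁻¹) :=
    fun i => (hG a haG' S HG 𝒟 i).1.mono hmono
  have hGinv : ∀ i, HolderSupOnLE (tildeInterval S.T (Params.τ ⟨β, α, a, b⟩ S.q) i)
      (fun s y => (gradPhi 𝒟.D i s y)⁻¹) 1 0 (C₁p * (mollScale β α a b S.q)⁻¹) :=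
    fun i => (hG a haG' S HG 𝒟 i).2.mono hmono
  -- scales
  have hf1 : 0 < freq a b (S.q + 1) := freq_pos ha1 _
  have h1f : 1 ≤ freq a b (S.q + 1) := one_le_freq ha1 _
  have hL : (mollScale β α a b S.q)⁻¹ ≤ freq a b (S.q + 1) := by
    have h := h66 a ha₆' S.q
    calc (mollScale β α a b S.q)⁻¹
        = (mollScale β α a b S.q)⁻¹ * (freq a b (S.q + 1))⁻¹ * freq a b (S.q + 1) := by
          field_simp
      _ ≤ 1 * freq a b (S.q + 1) := mul_le_mul_of_nonneg_right h hf1.le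
      _ = freq a b (S.q + 1) := one_mul _
  have hn : (Params.freqNat ⟨β, α, a, b⟩ (S.q + 1) : ℝ) ≤ freq a b (S.q + 1) :=
    Params.freqNat_le_freq ⟨β, α, a, b⟩ (by show (0 : ℝ) ≤ a; linarith) (S.q + 1)
  have hσ : Real.sqrt (amp β a b (S.q + 1) / c₀) = Real.sqrt (amp β a b (S.q + 1)) / Real.sqrt c₀ :=
    Real.sqrt_div (amp_pos ha1 _).le c₀
  constructor
  · -- the sup bound (5.33)
    intro t ht x
    have h := 𝒟.norm_principalPart_le H1 𝔚 hc₀ hCp0 ha1 hb1.le hβ.le hα.le h4q hKW0 hKW ht x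
    exact h.trans (mul_le_mul_of_nonneg_right (le_max_left _ _) (Real.sqrt_nonneg _))
  · -- the derivative bound (5.35) and (6.6)
    intro j t ht x
    have hpt : ‖partialDeriv j (principalPart ⟨β, α, a, b⟩ S 𝔚 𝒟.cut.η 𝒟.D t) x‖ ≤
        9 * Real.sqrt (amp β a b (S.q + 1) / c₀) *
          (2 * Real.exp (4 * Cp) ^ 2 *
              (CW * (9 * Real.exp (4 * Cp) * (2 * (1 + 8 * Cp) * (C₁p * (mollScale β α a b S.q)⁻¹) +
                Real.exp (4 * Cp) * (8 * Cp * (mollScale β α a b S.q)⁻¹)) +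
                (Params.freqNat ⟨β, α, a, b⟩ (S.q + 1) : ℝ) * (3 * Real.exp (4 * Cp)))) +
            C₁p * (mollScale β α a b S.q)⁻¹ * KW +
            max (Cη 0 1) 0 * (2 * Real.exp (4 * Cp) ^ 2) * KW) :=
      𝒟.norm_partialDeriv_principalPart_le H1 𝔚 le_rfl hc₀ hCp0 ha1 hb1.le hβ.le hα.le h4q hKW0 hKW
        hCW0 hCW (B₁ := C₁p * (mollScale β α a b S.q)⁻¹) (by positivity) hG1 hGinv ht j x
    rw [← hE] at hpt
    set L : ℝ := (mollScale β α a b S.q)⁻¹ with hLdef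
    set nn : ℝ := (Params.freqNat ⟨β, α, a, b⟩ (S.q + 1) : ℝ) with hnn
    set lam : ℝ := freq a b (S.q + 1) with hlam
    have hL0 : 0 ≤ L := inv_nonneg.2 hℓ.le
    have hnn0 : 0 ≤ nn := Nat.cast_nonneg _
    -- the bracket is `A₁ L + A₂ n + A₃ ≤ (A₁ + A₂ + A₃) λ_{q+1}`
    have hT : 2 * E ^ 2 * (CW * (9 * E * (2 * (1 + 8 * Cp) * (C₁p * L) + E * (8 * Cp * L)) +
        nn * (3 * E))) + C₁p * L * KW + max (Cη 0 1) 0 * (2 * E ^ 2) * KW ≤ (A₁ + A₂ + A₃) * lam := by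
      have e : 2 * E ^ 2 * (CW * (9 * E * (2 * (1 + 8 * Cp) * (C₁p * L) + E * (8 * Cp * L)) +
          nn * (3 * E))) + C₁p * L * KW + max (Cη 0 1) 0 * (2 * E ^ 2) * KW =
          A₁ * L + A₂ * nn + A₃ := by
        rw [hA₁, hA₂, hA₃]; ring
      rw [e]
      have i1 : A₁ * L ≤ A₁ * lam := mul_le_mul_of_nonneg_left hL hA₁0
      have i2 : A₂ * nn ≤ A₂ * lam := mul_le_mul_of_nonneg_left hn hA₂0
      have i3 : A₃ ≤ A₃ * lam := le_mul_of_one_le_right hA₃0 h1f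
      linarith
    have hs0 : 0 ≤ Real.sqrt (amp β a b (S.q + 1)) := Real.sqrt_nonneg _
    have hc0 : 0 < Real.sqrt c₀ := Real.sqrt_pos.2 hc₀
    calc ‖partialDeriv j (principalPart ⟨β, α, a, b⟩ S 𝔚 𝒟.cut.η 𝒟.D t) x‖
        ≤ 9 * Real.sqrt (amp β a b (S.q + 1) / c₀) *
            (2 * E ^ 2 * (CW * (9 * E * (2 * (1 + 8 * Cp) * (C₁p * L) + E * (8 * Cp * L)) +
              nn * (3 * E))) + C₁p * L * KW + max (Cη 0 1) 0 * (2 * E ^ 2) * KW) := hpt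
      _ ≤ 9 * Real.sqrt (amp β a b (S.q + 1) / c₀) * ((A₁ + A₂ + A₃) * lam) :=
          mul_le_mul_of_nonneg_left hT (by positivity)
      _ = Kd * (Real.sqrt (amp β a b (S.q + 1)) * lam) := by
          rw [hσ, hKd]
          field_simp
      _ ≤ max Ko Kd * (Real.sqrt (amp β a b (S.q + 1)) * freq a b (S.q + 1)) :=
          mul_le_mul_of_nonneg_right (le_max_right _ _) (mul_nonneg hs0 hf1.le)

end Assembly

end BDSV

end Literature.Analysis.FluidPDE
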